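import Mathlib
import Summits.ValiantsHypothesis.ValiantsHypothesis.Theses.LacunarySymmetroid
import Summits.ValiantsHypothesis.ValiantsHypothesis.Theorems.MatrixDescartes.Negative.MatrixDescartesSymmetryFree

/-!
# Sketch — ideation seat val-idea-25 g0 (technique (f): open-question harvest), crux `MatrixDescartes`
(stmt-ValiantsHypothesis-18050, route `LacunarySymmetroid`).

HONEST FRAMING. Nothing here proves `MatrixDescartes`, Conjecture B or VP ≠ VNP. This file only TYPES the
restricted V1 sub-cases of two crux-idea cards and their first lemmas, over existing declarations:

* §1 `ProductPlusOne` — the support class "all letters diagonal except one diagonal-plus-cyclic letter";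
  its determinant is `∏_j f_j + c·X^(m·d l₀)` (printed open family `f₁⋯f_m + 1`, Koiran–Portier–Tavenas–Thomassé
  2015 §5; `fg+1`, Koiran–Portier–Tavenas 2015 §1).
* §2 `PowerSector` — sums of `k` products of powers of `M` base `K`-nomials on a common support
  (Koiran–Portier–Tavenas 2015 Thm 12: a THEOREM for `M k² = o(K)`, all sizes; open at their printed target).

Every `def … : Prop` is a statement, never asserted. PROVED here (no `sorry`): §1 S1 `det_cycMat` (det of
`diag f + t N_σ` over any commutative ring, Laplace along column 0), S1′ `pencilDetIdentity_holds`, S2 (Rolle step),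
S4 (Leibniz rule), and the DICTIONARY THEOREM `productPlusOneMDR_of_matrixDescartes : MatrixDescartes → ProductPlusOneMDR`
(V1 ⇒ the `f₁⋯f_m + c·x^{m d₀}` law in V1's own window; via the tree's `matrixDescartesGeneral_of_matrixDescartes`).
The conjectural items (`ProductPlusOneMDR`, `PPOLinearLaw`, `PPOPolyLaw`, `PosCoeffRung`, §2) stay `def`s.
-/

set_option linter.dupNamespace false

open Polynomial Finset BigOperators

namespace Summit.ValiantsHypothesis.ValiantsHypothesis.Cruxes.MatrixDescartes

/-- A `K`-nomial on the common support `d` with coefficient row `a`. -/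
noncomputable def fewnomial {K : ℕ} (d : Fin K → ℕ) (a : Fin K → ℝ) : ℝ[X] :=
  ∑ l, C (a l) * X ^ (d l)

namespace ProductPlusOne

open Summit.ValiantsHypothesis.ValiantsHypothesis.Theorems.MatrixDescartes.Negative (MatrixDescartesGeneral
  matrixDescartesGeneral_of_matrixDescartes)

/-- The product-plus-monomial family `c·X^(m·d l₀) + ∏_{j<m} f_j`, all `f_j` on the common support `d`
(on `(0,∞)` its zeros are those of `c + ∏_j (f_j / X^(d l₀))`, the printed `f₁⋯f_m + 1` shape). -/
noncomputable def prodPlusMonomial {m K : ℕ} (d : Fin K → ℕ) (a : Fin m → Fin K → ℝ) (l₀ : Fin K) (c : ℝ) : ℝ[X] :=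
  C c * X ^ (m * d l₀) + ∏ j, fewnomial d (a j)

/-- Row predicate of the class at format `(m, K)`: every member has at most `B` distinct real zeros
(crux currency: `roots.toFinset.card`, zero polynomial has none). -/
def PPOLawAt (m K B : ℕ) : Prop :=
  ∀ (d : Fin K → ℕ) (a : Fin m → Fin K → ℝ) (l₀ : Fin K) (c : ℝ),
    (prodPlusMonomial d a l₀ c).roots.toFinset.card ≤ B

/-- **RESTRICTED V1 (the sub-case this card would prove).** `MatrixDescartes`' rate `2^{o(K log K)}` and window
`m ≤ 2^((log₂K+c)^c)`, verbatim, on the product-plus-one class. A CONSEQUENCE of V1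
(`productPlusOneMDR_of_matrixDescartes`, proved below); implied by Koiran's real τ-conjecture at top fan-in 2; open. -/
def ProductPlusOneMDR : Prop :=
  ∀ c q : ℕ, 0 < q → ∃ K₀ : ℕ, ∀ K m : ℕ, K₀ ≤ K → m ≤ 2 ^ ((Nat.log 2 K + c) ^ c) →
    ∀ (d : Fin K → ℕ) (a : Fin m → Fin K → ℝ) (l₀ : Fin K) (c₀ : ℝ),
      (prodPlusMonomial d a l₀ c₀).roots.toFinset.card ^ q ≤ 2 ^ (K * Nat.log 2 K)

/-- **Located sharp form (conjecture PPO-lin of this card, offered for refutation):** a law LINEAR in `m·K`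
(all distinct real zeros; in positive-zeros currency `Z₊ ≤ mK + 1`, the class being closed under `x ↦ −x`).
Rolle forces `Z₊ ≥ m(K−1)` on members; Descartes allows `Z₊ ≤ D(m,K) = C(m+K−1, m) − 1` (the class has the
format's monomial support); first formats where the two are separated: `(2,5)` 11 vs 14, `(3,4)` 13 vs 19. -/
def PPOLinearLaw : Prop := ∀ m K : ℕ, PPOLawAt m K (2 * m * K + 3)

/-- **Polynomial form (conjecture PPO-poly):** what real τ at top fan-in 2 predicts for the class. -/
def PPOPolyLaw : Prop := ∃ C : ℕ, ∀ m K : ℕ, PPOLawAt m K ((m * K + 2) ^ C)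

/-- The cyclic coupling letter `N_σ`: `1` on the superdiagonal, `σ` in the corner `(m−1, 0)`
(for `m = 1` the single entry is `σ`). -/
def cyclicShift (m : ℕ) (σ : ℝ) : Matrix (Fin m) (Fin m) ℝ :=
  Matrix.of fun i j => if (j : ℕ) = (i : ℕ) + 1 then 1 else if (i : ℕ) + 1 = m ∧ (j : ℕ) = 0 then σ else 0

/-- The class as a `K`-letter lacunary pencil (general real coefficients; symmetric after the §B doubling
`matrixDescartesGeneral_of_matrixDescartes`): letter `l` is `diag(a · l)`, and letter `l₀` carries `N_σ` in addition. -/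
noncomputable def classPencil {m K : ℕ} (σ : ℝ) (a : Fin m → Fin K → ℝ) (l₀ : Fin K) :
    Fin K → Matrix (Fin m) (Fin m) ℝ :=
  fun l => Matrix.diagonal (fun j => a j l) + (if l = l₀ then (1 : ℝ) else 0) • cyclicShift m σ

section CycDet
/-! ### (S1) the determinant identity — PROVED
`det (diag f + t·N_σ) = ∏ f_j + (−1)^n σ t^{n+1}` on `Fin (n+1)` over any commutative ring: Laplace along
column 0; the two minors are upper / lower bidiagonal. -/
variable {R : Type*} [CommRing R]

/-- `diag f` + `t` on the superdiagonal + `t σ` in the corner `(n, 0)` (size `n + 1`). -/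
def cycMat (n : ℕ) (f : Fin (n+1) → R) (t σ : R) : Matrix (Fin (n+1)) (Fin (n+1)) R :=
  Matrix.of fun i j => (if i = j then f i else 0) + (if (j : ℕ) = (i : ℕ) + 1 then t else 0)
    + (if (i : ℕ) + 1 = n + 1 ∧ (j : ℕ) = 0 then t * σ else 0)

theorem cycMat_apply (n : ℕ) (f : Fin (n+1) → R) (t σ : R) (i j : Fin (n+1)) :
    cycMat n f t σ i j = (if i = j then f i else 0) + (if (j : ℕ) = (i : ℕ) + 1 then t else 0)
      + (if (i : ℕ) + 1 = n + 1 ∧ (j : ℕ) = 0 then t * σ else 0) := rfl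

theorem cycMat_col_zero (n : ℕ) (f : Fin (n+2) → R) (t σ : R) (i : Fin (n+2)) :
    cycMat (n+1) f t σ i 0 = (if i = 0 then f 0 else 0) + (if i = Fin.last (n+1) then t * σ else 0) := by
  rw [cycMat_apply]
  have h2 : ¬ (((0 : Fin (n+2)) : ℕ) = (i : ℕ) + 1) := by simp
  rw [if_neg h2, add_zero]
  congr 1
  · by_cases h : i = 0
    · subst h; simp
    · simp [h]
  · by_cases h : i = Fin.last (n+1)
    · subst h; simp
    · have : ¬ ((i : ℕ) = n + 1) := by
        intro hh; apply h; ext; simp [Fin.val_last, hh]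
      simp [h, this]

theorem cycMat_minor00_apply (n : ℕ) (f : Fin (n+2) → R) (t σ : R) (i j : Fin (n+1)) :
    cycMat (n+1) f t σ i.succ j.succ = (if i = j then f i.succ else 0) + (if (j : ℕ) = (i : ℕ) + 1 then t else 0) := by
  rw [cycMat_apply]
  have h3 : ¬ (((i.succ : Fin (n+2)) : ℕ) + 1 = n + 1 + 1 ∧ ((j.succ : Fin (n+2)) : ℕ) = 0) := by
    simp [Fin.val_succ]
  rw [if_neg h3, add_zero]
  congr 1
  · by_cases h : i = j
    · subst h; simp
    · have : (i.succ : Fin (n+2)) ≠ j.succ := fun e => h (Fin.succ_injective _ e)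
      simp [h, this]
  · simp [Fin.val_succ]

theorem cycMat_minorLast_apply (n : ℕ) (f : Fin (n+2) → R) (t σ : R) (i j : Fin (n+1)) :
    cycMat (n+1) f t σ (Fin.castSucc i) j.succ
      = (if (i : ℕ) = (j : ℕ) + 1 then f (Fin.castSucc i) else 0) + (if (j : ℕ) = (i : ℕ) then t else 0) := by
  rw [cycMat_apply]
  have h3 : ¬ (((Fin.castSucc i : Fin (n+2)) : ℕ) + 1 = n + 1 + 1 ∧ ((j.succ : Fin (n+2)) : ℕ) = 0) := by
    simp [Fin.val_succ]
  rw [if_neg h3, add_zero]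
  congr 1
  · by_cases h : (i : ℕ) = (j : ℕ) + 1
    · have : (Fin.castSucc i : Fin (n+2)) = j.succ := by ext; simp [Fin.val_succ, h]
      simp [h, this]
    · have : (Fin.castSucc i : Fin (n+2)) ≠ j.succ := by
        intro e; apply h; have := congrArg Fin.val e; simpa [Fin.val_succ] using this
      simp [h, this]
  · simp [Fin.val_succ, eq_comm]

/-- minor at `(0,0)`: upper bidiagonal, determinant `∏_{j ≥ 1} f_j`. -/
theorem det_cycMat_minor00 (n : ℕ) (f : Fin (n+2) → R) (t σ : R) :
    ((cycMat (n+1) f t σ).submatrix Fin.succ Fin.succ).det = ∏ j : Fin (n+1), f j.succ := by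
  have hT : ((cycMat (n+1) f t σ).submatrix Fin.succ Fin.succ).BlockTriangular id := by
    intro i j hij
    have hij' : (j : ℕ) < (i : ℕ) := hij
    rw [Matrix.submatrix_apply, cycMat_minor00_apply]
    have h1 : i ≠ j := by intro h; subst h; exact lt_irrefl _ hij'
    have h2 : ¬ ((j : ℕ) = (i : ℕ) + 1) := by omega
    simp [h1, h2]
  rw [Matrix.det_of_upperTriangular hT]
  refine Finset.prod_congr rfl fun j _ => ?_
  rw [Matrix.submatrix_apply, cycMat_minor00_apply]; simp

/-- minor at `(n+1, 0)`: lower bidiagonal with `t` on the diagonal, determinant `t^{n+1}`. -/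
theorem det_cycMat_minorLast (n : ℕ) (f : Fin (n+2) → R) (t σ : R) :
    ((cycMat (n+1) f t σ).submatrix Fin.castSucc Fin.succ).det = t ^ (n+1) := by
  have hT : ((cycMat (n+1) f t σ).submatrix Fin.castSucc Fin.succ).BlockTriangular OrderDual.toDual := by
    intro i j hij
    have hij' : (i : ℕ) < (j : ℕ) := hij
    rw [Matrix.submatrix_apply, cycMat_minorLast_apply]
    have h1 : ¬ ((i : ℕ) = (j : ℕ) + 1) := by omega
    have h2 : ¬ ((j : ℕ) = (i : ℕ)) := by omega
    simp [h1, h2]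
  rw [Matrix.det_of_lowerTriangular _ hT]
  have : ∀ j : Fin (n+1), cycMat (n+1) f t σ (Fin.castSucc j) j.succ = t := by
    intro j; rw [cycMat_minorLast_apply]; simp
  simp only [Matrix.submatrix_apply, this, Finset.prod_const, Finset.card_univ, Fintype.card_fin]

/-- **(S1, PROVED) determinant of `diag f + t N_σ`:** only `id` and the full `(n+1)`-cycle survive. -/
theorem det_cycMat (n : ℕ) (f : Fin (n+1) → R) (t σ : R) :
    (cycMat n f t σ).det = ∏ j, f j + (-1) ^ n * σ * t ^ (n+1) := by
  cases n with
  | zero =>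
    rw [Matrix.det_fin_one, cycMat_apply]
    simp
    ring
  | succ n =>
    rw [Matrix.det_succ_column_zero, Fin.sum_univ_succ, Finset.sum_eq_single (Fin.last n)]
    · simp only [cycMat_col_zero, Fin.succ_last, Fin.succAbove_zero, Fin.succAbove_last]
      rw [det_cycMat_minor00, det_cycMat_minorLast]
      conv_rhs => rw [Fin.prod_univ_succ]
      have h0 : ¬ ((0 : Fin (n+2)) = Fin.last (n+1)) := by
        simp [Fin.ext_iff]
      have hl0 : ¬ (Fin.last (n+1) = (0 : Fin (n+2))) := fun e => h0 e.symm
      simp only [h0, hl0, if_true, if_false, add_zero, zero_add, Fin.val_zero, pow_zero, one_mul,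
        Fin.val_last, Nat.succ_eq_add_one, pow_succ, pow_zero]
      ring
    · intro b _ hb
      have hb' : (b.succ : Fin (n+2)) ≠ 0 := Fin.succ_ne_zero b
      have hb'' : (b.succ : Fin (n+2)) ≠ Fin.last (n+1) := by
        rw [← Fin.succ_last]; exact fun e => hb (Fin.succ_injective _ e)
      simp [cycMat_col_zero, hb', hb'']
    · intro h; exact absurd (Finset.mem_univ _) h

end CycDet

theorem classPencil_apply {m K : ℕ} (σ : ℝ) (a : Fin m → Fin K → ℝ) (l₀ l : Fin K) (i j : Fin m) :
    classPencil σ a l₀ l i j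
      = (if i = j then a i l else 0) + (if l = l₀ then (1:ℝ) else 0) * cyclicShift m σ i j := rfl

/-- entries of the class pencil's polynomial matrix. -/
theorem pencil_apply {m K : ℕ} (σ : ℝ) (d : Fin K → ℕ) (a : Fin m → Fin K → ℝ) (l₀ : Fin K) (i j : Fin m) :
    (∑ l, ((X : ℝ[X]) ^ d l) • (classPencil σ a l₀ l).map C) i j
      = (if i = j then fewnomial d (a i) else 0) + X ^ d l₀ * C (cyclicShift m σ i j) := by
  rw [Matrix.sum_apply]
  have : ∀ l, (((X : ℝ[X]) ^ d l) • (classPencil σ a l₀ l).map C) i j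
      = (if i = j then C (a i l) * X ^ d l else 0)
        + (if l = l₀ then X ^ d l * C (cyclicShift m σ i j) else 0) := by
    intro l
    rw [Matrix.smul_apply, Matrix.map_apply, classPencil_apply, smul_eq_mul, map_add, map_mul, mul_add]
    congr 1
    · by_cases hij : i = j
      · subst hij; simp only [if_true]; exact mul_comm _ _
      · simp [hij]
    · by_cases hl : l = l₀
      · subst hl; simp
      · simp [hl]
  rw [Finset.sum_congr rfl (fun l _ => this l), Finset.sum_add_distrib, Finset.sum_ite_eq' Finset.univ l₀]
  simp only [Finset.mem_univ, if_true]
  congr 1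
  by_cases hij : i = j
  · simp [hij, fewnomial]
  · simp [hij]

/-- the class pencil's polynomial matrix IS `cycMat` with `t = x^{d l₀}`. -/
theorem pencil_eq_cycMat (n K : ℕ) (σ : ℝ) (d : Fin K → ℕ) (a : Fin (n+1) → Fin K → ℝ) (l₀ : Fin K) :
    (∑ l, ((X : ℝ[X]) ^ d l) • (classPencil σ a l₀ l).map C)
      = cycMat n (fun j => fewnomial d (a j)) (X ^ d l₀) (C σ) := by
  ext i j
  rw [pencil_apply, cycMat_apply, add_assoc]
  congr 1
  simp only [cyclicShift, Matrix.of_apply]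
  by_cases hA : (j : ℕ) = (i : ℕ) + 1
  · have hB : ¬ ((i : ℕ) + 1 = n + 1 ∧ (j : ℕ) = 0) := by omega
    rw [if_pos hA, if_pos hA, if_neg hB]; simp
  · rw [if_neg hA, if_neg hA]
    by_cases hB : ((i : ℕ) + 1 = n + 1 ∧ (j : ℕ) = 0)
    · rw [if_pos hB, if_pos hB]; simp
    · rw [if_neg hB, if_neg hB]; simp

/-- **(S1′) pencil form of the identity:** the class pencil's determinant is the product-plus-monomial family. -/
def PencilDetIdentity : Prop :=
  ∀ (m K : ℕ) (σ : ℝ) (d : Fin K → ℕ) (a : Fin m → Fin K → ℝ) (l₀ : Fin K), 1 ≤ m →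
    Matrix.det (∑ l, ((X : ℝ[X]) ^ d l) • (classPencil σ a l₀ l).map C)
      = prodPlusMonomial d a l₀ ((-1) ^ (m - 1) * σ)

/-- **(S1″) the embedding:** general-form V1 restricted to the class IS `ProductPlusOneMDR`. -/
def Embedding : Prop := MatrixDescartesGeneral → ProductPlusOneMDR

/-- **(S1″, PROVED modulo S1′):** the determinant identity is the only input of the embedding
(`m = 0`: the member is the constant `c₀ + 1`, no roots; `m ≥ 1`: instantiate the general crux at the class
pencil with `σ = (−1)^{m−1} c₀` and rewrite). -/
theorem embedding_of_pencilDetIdentity (hId : PencilDetIdentity) : Embedding := by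
  intro hG c q hq
  obtain ⟨K₀, hK₀⟩ := hG c q hq
  refine ⟨K₀, fun K m hK hm d a l₀ c₀ => ?_⟩
  rcases Nat.eq_zero_or_pos m with rfl | hmpos
  · have h0 : (prodPlusMonomial d a l₀ c₀).roots.toFinset.card = 0 := by
      have : prodPlusMonomial d a l₀ c₀ = C (c₀ + 1) := by
        simp [prodPlusMonomial, map_add]
      rw [this, Polynomial.roots_C]; simp
    rw [h0, zero_pow hq.ne']; exact Nat.zero_le _
  · have h := hK₀ K m hK hm d (classPencil ((-1) ^ (m - 1) * c₀) a l₀)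
    rw [hId m K _ d a l₀ hmpos] at h
    have hc : (-1 : ℝ) ^ (m - 1) * ((-1) ^ (m - 1) * c₀) = c₀ := by
      rw [← mul_assoc, ← pow_add, ← two_mul, pow_mul]; simp
    simpa [hc] using h

/-- **(S1′, PROVED):** the class pencil's determinant is the product-plus-monomial family. -/
theorem pencilDetIdentity_holds : PencilDetIdentity := by
  intro m K σ d a l₀ hm
  obtain ⟨n, rfl⟩ : ∃ n, m = n + 1 := ⟨m - 1, by omega⟩
  rw [pencil_eq_cycMat, det_cycMat, prodPlusMonomial]
  simp only [Nat.add_sub_cancel, map_mul, map_pow, map_neg, map_one, ← pow_mul]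
  rw [Nat.mul_comm (d l₀) (n + 1)]
  ring

/-- **DICTIONARY THEOREM (PROVED): general-form V1 ⇒ the `f₁⋯f_m + c·x^{m d₀}` real-root law in V1's window.** -/
theorem embedding_holds : Embedding := embedding_of_pencilDetIdentity pencilDetIdentity_holds

/-- **(PROVED) V1 `MatrixDescartes` itself ⇒ `ProductPlusOneMDR`** (via the tree's symmetry-free form, §B doubling). -/
theorem productPlusOneMDR_of_matrixDescartes
    (h : Summit.ValiantsHypothesis.ValiantsHypothesis.Theses.LacunarySymmetroid.MatrixDescartes) :
    ProductPlusOneMDR :=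
  embedding_holds (matrixDescartesGeneral_of_matrixDescartes h)

/-- **(S2, Rolle step; proved):** adding a constant costs at most one root beyond the critical points. -/
theorem card_roots_C_add_le (g : ℝ[X]) (c : ℝ) :
    (C c + g).roots.toFinset.card ≤ (derivative g).roots.toFinset.card + 1 := by
  have h := Polynomial.card_roots_toFinset_le_derivative (C c + g)
  simpa [derivative_add, derivative_C] using h

/-- **(S3, positive-coefficient rung; provable now by log-convexity of exponential sums):** if every `f_j` has
nonnegative coefficients then `∏ f_j − c` (`c > 0`) has at most two positive zeros — for EVERY `m` and `K`. -/
def PosCoeffRung : Prop :=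
  ∀ (m K : ℕ) (d : Fin K → ℕ) (a : Fin m → Fin K → ℝ) (c : ℝ), (∀ j l, 0 ≤ a j l) → 0 < c →
    ((∏ j, fewnomial d (a j) - C c).roots.toFinset.filter (fun t => 0 < t)).card ≤ 2

/-- **(S4, the logarithmic-derivative reduction; provable now):** on `(0,∞)` minus the zeros of `g = ∏ f_j`,
critical points of `g` are zeros of `Ψ = Σ_j f_j′/f_j`; so the class count is
`≤ 2 + m(K−1) + #{zeros of Ψ off the zero set of g}`. Typed as the polynomial identity behind it. -/
def LogDerivIdentity : Prop :=
  ∀ (m : ℕ) (f : Fin m → ℝ[X]),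
    derivative (∏ j, f j) = ∑ j, derivative (f j) * ∏ i ∈ Finset.univ.erase j, f i

/-- **(S4, PROVED):** Leibniz rule for finite products (Mathlib `Polynomial.derivative_prod_finset`). -/
theorem logDerivIdentity_holds : LogDerivIdentity := by
  intro m f
  rw [Polynomial.derivative_prod_finset]
  refine Finset.sum_congr rfl fun j _ => ?_
  ring

end ProductPlusOne

namespace PowerSector

/-- Sums of `k` products of powers of `M` base `K`-nomials on the common support `d`
(Grenet–Koiran–Portier–Strozecki / Koiran–Portier–Tavenas family, common-support case = `K`-letter ABP pencils
made of `k` disjoint chains). -/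
noncomputable def powerSum {k M K : ℕ} (d : Fin K → ℕ) (a : Fin M → Fin K → ℝ) (cf : Fin k → ℝ)
    (α : Fin k → Fin M → ℕ) : ℝ[X] :=
  ∑ i, C (cf i) * ∏ j, (fewnomial d (a j)) ^ (α i j)

/-- **Koiran–Portier–Tavenas 2015, Theorem 12** (J. Symb. Comput. 68; arXiv:1205.1015), typed as a NAMED FACT
(not proved in the tree): `Z_ℝ(Σ_{i<k} c_i ∏_{j<M} f_j^{α_ij}) ≤ 4kKM + 4(e(1+K))^{M k²/2}` for `K`-nomials `f_j`
(their `t = K`, their `m = M`), whenever the sum is not identically zero. -/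
def KPTTheorem12 : Prop :=
  ∀ (k M K : ℕ) (d : Fin K → ℕ) (a : Fin M → Fin K → ℝ) (cf : Fin k → ℝ) (α : Fin k → Fin M → ℕ),
    powerSum d a cf α ≠ 0 →
      ((powerSum d a cf α).roots.toFinset.card : ℝ)
        ≤ 4 * k * K * M + 4 * (Real.exp 1 * (1 + K)) ^ ((M : ℝ) * (k : ℝ) ^ 2 / 2)

/-- **RESTRICTED V1 on the power sector, PROVED REGIME (the sub-case this card would land):** for
`M·k² ≤ √K` the crux's rate holds for ALL sizes (no window needed): `KPTTheorem12 → PowerSectorMDR` is arithmetic. -/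
def PowerSectorMDR : Prop :=
  ∀ q : ℕ, 0 < q → ∃ K₀ : ℕ, ∀ K k M : ℕ, K₀ ≤ K → M * k ^ 2 ≤ Nat.sqrt K →
    ∀ (d : Fin K → ℕ) (a : Fin M → Fin K → ℝ) (cf : Fin k → ℝ) (α : Fin k → Fin M → ℕ),
      (powerSum d a cf α).roots.toFinset.card ^ q ≤ 2 ^ (K * Nat.log 2 K)

/-- **FIRST LEMMA of the power-sector card:** the printed theorem gives the restricted V1. -/
def FirstLemma : Prop := KPTTheorem12 → PowerSectorMDR

/-- **The printed open target (KPT 2015 §1: "a `(kt)^{O(1)} 2^{O(m)}` upper bound"), typed:** it would extend the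
proved regime to `M = o(K log K)` distinct base fewnomials. -/
def KPTTarget : Prop :=
  ∃ C : ℕ, ∀ (k M K : ℕ) (d : Fin K → ℕ) (a : Fin M → Fin K → ℝ) (cf : Fin k → ℝ) (α : Fin k → Fin M → ℕ),
    (powerSum d a cf α).roots.toFinset.card ≤ ((k + 1) * (K + 1)) ^ C * 2 ^ (C * M)

/-- **Full restricted V1 on the power sector (open; implied by real τ):** all `k, M` with pencil size
`Σ α` in the crux window. -/
def PowerSectorMDRFull : Prop :=
  ∀ c q : ℕ, 0 < q → ∃ K₀ : ℕ, ∀ K k M : ℕ, K₀ ≤ K →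
    ∀ (d : Fin K → ℕ) (a : Fin M → Fin K → ℝ) (cf : Fin k → ℝ) (α : Fin k → Fin M → ℕ),
      (k + ∑ i, ∑ j, α i j) ≤ 2 ^ ((Nat.log 2 K + c) ^ c) →
      (powerSum d a cf α).roots.toFinset.card ^ q ≤ 2 ^ (K * Nat.log 2 K)

end PowerSector

end Summit.ValiantsHypothesis.ValiantsHypothesis.Cruxes.MatrixDescartes
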